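import Literature.Probability.LatticeModels.InterfaceSLEIdentification
import Literature.Probability.Process.LevyCharacterisation
import Literature.Probability.RandomPlanarGeometry.SLEExistenceConverse
import HarnessLib

/-!
# Critical Ising interfaces and SLE₃: selection rules, and the Rohde–Schramm inputs are necessary

Topic `Literature/Probability/LatticeModels` (family `crit-ising`). Fifth file of the
decomposition of **crit-ising.S17, spin half** — Chelkak–Duminil-Copin–Hongler–Kemppainen–Smirnov,
*Convergence of Ising interfaces to Schramm's SLE curves*, C. R. Math. Acad. Sci. Paris 352 (2014)
157–161 (arXiv:1312.0533), Theorem 1, in its corrected transcription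
`convergesInLawToSLE_three_isingInterface_zd` (`InterfaceSLEProofs.lean`) — after
`InterfaceSLEProofs.lean` (F1 ∧ F2 ∧ uniqueness ⟹ S17-zd), `InterfaceSLETightness.lean`
((C1) ⟹ F1) and `InterfaceSLEIdentification.lean` (uniqueness in law discharged:
(C1) ∧ F2 ⟹ S17-zd; the two CDHKS martingales in Lévy's format).

Bookkeeping for the tenure on the fact, theorems only (no definition, no named fact):

* **Interface-selection rules exist** (`exists_isInterfaceSelection`,
  `exists_forall_isInterfaceSelection`), so the universally quantified selection rule of the
  S17 statements never makes them vacuous.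
* **The Rohde–Schramm inputs at `κ = 3` are necessary**: in H21's encoding a convergence in law to
  chordal SLE₃ exhibits an SLE₃ random curve (`ConvergesInLawToSLE` ∋ `IsSLECurve 3 D Γ`), whose
  almost-sure clause contains "the Loewner chain of `√3 B` is generated by its trace" and whose
  compactified image ends at `b`; hence on every Dobrushin domain admitting a family of admissible
  discretisations (`IsDiscretisation D E`) the corrected statement entails `HasSLETrace 3`
  (`hasSLETrace_three_of_convergesInLawToSLE_zd`; Rohde–Schramm 2005, Thm. 5.1 at `κ = 3`) and
  almost-sure transience of the SLE₃ trace
  (`ae_tendsto_norm_sleTrace_three_of_convergesInLawToSLE_zd`; Rohde–Schramm 2005, Thm. 7.1), by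
  the tree's `ConvergesInLawToSLE.hasSLETrace` and `IsSLECurve.ae_tendsto_norm_sleTrace_atTop`
  (`SLEExistenceConverse.lean`); and already the identification fact F2
  `isSLELaw_three_of_subseqLimit_spinInterface` does so on every instance of its hypotheses
  (`hasSLETrace_three_of_isSLELaw_subseqLimit`), resp. together with (C1)
  (`hasSLETrace_three_of_traversalBound_of_isSLELaw`,
  `ae_tendsto_norm_sleTrace_three_of_traversalBound_of_isSLELaw`). So no proof of F2 or of the
  corrected statement can bypass Rohde–Schramm's theorems at `κ = 3` on a non-vacuous instance —
  and indeed the tree proves them (`SLELawOfDrivingProcessLocal.lean`, used from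
  `InterfaceSLEFrontier.lean` on).

**Review note (D-0026, 2026-08-15).** Earlier versions of this file also recorded assemblies
through the named fact (M) `exists_drivingMartingales_of_subseqLimit_spinInterface` (CDHKS Thm. 3
and §3: a driving process with `W_t`, `W_t² - 3t` martingales for every subsequential limit) with
Lévy's characterisation discharged (`Process.levy_characterisation_holds`). The D-0026 review of
(M) (2026-08-15) found it to be a decomposition slice of F2 — F2 minus the last sentence of its
printed proof (Lévy's theorem), with the same unvendored inputs (Kemppainen–Smirnov 2017,
Thm. 1.5; Chelkak–Smirnov 2012, Thms 1.2, 5.6) — and merges it back into F2's proof obligation: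
this file no longer routes anything through it. Those assemblies were in any case superseded by
the unconditional forms of `InterfaceSLEFrontier.lean` (the Rohde–Schramm inputs being theorems
there), where the passage "two driving martingales ⟹ SLE₃ law" is kept as a theorem with the
martingales as explicit hypotheses. The named-fact frontier below
`convergesInLawToSLE_three_isingInterface_zd` is then `spinInterface_traversalBound` (C1) and
`isSLELaw_three_of_subseqLimit_spinInterface` (F2).

## References

* D. Chelkak, H. Duminil-Copin, C. Hongler, A. Kemppainen, S. Smirnov, *Convergence of Ising
  interfaces to Schramm's SLE curves*, C. R. Math. Acad. Sci. Paris 352 (2014) 157–161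
  (arXiv:1312.0533): Thm. 1 (arXiv p. 4), §1 ("it could also turn arbitrarily in ambiguous
  situations with four alternating spins around a face"), §3 (proof of Thm. 1).
* S. Rohde, O. Schramm, *Basic properties of SLE*, Ann. Math. 161 (2005) 883–924, Thms 5.1, 7.1.
-/

noncomputable section

open MeasureTheory Filter Topology
open scoped NNReal BoundedContinuousFunction
open Literature.Probability.LatticeModels Literature.Probability.Percolation
open Literature.Probability.RandomPlanarGeometry (CurveClass DobrushinDomain HasSLETrace sleTrace)

namespace Literature.Probability.LatticeModels

/-! ### Interface-selection rules exist -/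

/-- **Interface-selection rules exist** for every discrete Dobrushin datum: choose, for each
configuration admitting a Dobrushin interface, one of them (and anything, say `[]`, otherwise).
In particular the universally quantified selection rule of crit-ising.S17 never makes the
statement vacuous. (CDHKS 2014, §1: "it could also turn arbitrarily in ambiguous situations with
four alternating spins around a face".) [folklore] -/
theorem exists_isInterfaceSelection (E : DiscreteDobrushin) :
    ∃ sel : SpinConfig (Site 2) → List (Sym2 (Site 2)), IsInterfaceSelection E sel := by
  classical
  refine ⟨fun σ => if h : ∃ γ, IsDobrushinInterface E σ γ then h.choose else [], fun σ hσ => ?_⟩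
  simp only [dif_pos hσ]
  exact hσ.choose_spec

/-- A family of selection rules, one for each mesh, exists for every family of discrete
Dobrushin data. [folklore] -/
theorem exists_forall_isInterfaceSelection (E : ℝ → DiscreteDobrushin) :
    ∃ sel : ℝ → SpinConfig (Site 2) → List (Sym2 (Site 2)), ∀ δ, IsInterfaceSelection (E δ) (sel δ) := by
  choose sel hsel using fun δ => exists_isInterfaceSelection (E δ)
  exact ⟨sel, hsel⟩

/-! ### The Rohde–Schramm inputs at `κ = 3` are necessary -/

/-- **The corrected statement entails the existence of the SLE₃ trace** on every Dobrushin domain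
admitting admissible discretisations: it exhibits a family of interface curves converging in law
to chordal SLE₃ (`convergesInLawToSLE_three_isingInterface_zd.exists_convergesInLawToSLE`, the
only form in which this file consumes the statement, so as not to depend on its binder
structure), which in H21's encoding exhibits an SLE₃ random curve and hence `HasSLETrace 3`
(`ConvergesInLawToSLE.hasSLETrace`). Rohde–Schramm (2005), Thm. 5.1 is the statement witnessed.
[folklore] -/
theorem hasSLETrace_three_of_convergesInLawToSLE_zd
    (h : convergesInLawToSLE_three_isingInterface_zd) {D : DobrushinDomain}
    {E : ℝ → DiscreteDobrushin} (hE : IsDiscretisation D E) : HasSLETrace 3 := by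
  obtain ⟨X, hX⟩ := h.exists_convergesInLawToSLE hE
  exact hX.hasSLETrace

/-- **The corrected statement entails almost-sure transience of the SLE₃ trace** on every
Dobrushin domain admitting admissible discretisations (the SLE₃ random curve it exhibits,
`convergesInLawToSLE_three_isingInterface_zd.exists_convergesInLawToSLE`, has a compactified
image ending at `b`; `IsSLECurve.ae_tendsto_norm_sleTrace_atTop`). Rohde–Schramm (2005),
Thm. 7.1 at `κ = 3` is the statement witnessed. [folklore] -/
theorem ae_tendsto_norm_sleTrace_three_of_convergesInLawToSLE_zd
    (h : convergesInLawToSLE_three_isingInterface_zd) {D : DobrushinDomain}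
    {E : ℝ → DiscreteDobrushin} (hE : IsDiscretisation D E) :
    ∀ᵐ ω ∂Process.preWienerMeasure, Tendsto (fun t => ‖sleTrace 3 ω t‖) atTop atTop := by
  obtain ⟨X, Γ, hΓ, -, -⟩ := h.exists_convergesInLawToSLE hE
  exact hΓ.ae_tendsto_norm_sleTrace_atTop

/-- **F2 entails the existence of the SLE₃ trace on every instance of its hypotheses**: if the
critical spin-Ising interface laws of admissible discretisations of `(D; a, b)` converge weakly
along meshes `u n → 0⁺` to a probability measure `ν`, then — `ν` being the SLE₃ law by F2
`isSLELaw_three_of_subseqLimit_spinInterface`, which in H21's encoding exhibits an SLE₃ random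
curve (`IsSLELaw.hasSLETrace`) — SLE₃ is almost surely generated by a curve (Rohde–Schramm 2005,
Thm. 5.1 at `κ = 3`; Kemppainen–Smirnov 2017, Cor. 1.7, "also the limiting Loewner chain is
generated by a curve", is the printed form of this route to it).
[cite: KemppainenSmirnov2017, Cor. 1.7 (arXiv:1212.6215: Cor. 1.5)] -/
theorem hasSLETrace_three_of_isSLELaw_subseqLimit
    (h2 : isSLELaw_three_of_subseqLimit_spinInterface)
    {D : DobrushinDomain} {E : ℝ → DiscreteDobrushin} (hE : IsDiscretisation D E)
    {sel : ℝ → SpinConfig (Site 2) → List (Sym2 (Site 2))}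
    (hsel : ∀ δ, IsInterfaceSelection (E δ) (sel δ))
    {u : ℕ → ℝ} (hu : Tendsto u atTop (𝓝[>] 0))
    {ν : Measure (CurveClass ℂ)} [IsProbabilityMeasure ν]
    (hlim : ∀ f : CurveClass ℂ →ᵇ ℝ,
      Tendsto (fun n => ∫ c, f c ∂spinInterfaceLaw D E sel (u n)) atTop (𝓝 (∫ c, f c ∂ν))) :
    HasSLETrace 3 :=
  (h2 D E hE sel hsel u hu ν hlim).hasSLETrace

/-- **(C1) and F2 entail the existence of the SLE₃ trace** on every Dobrushin domain admitting
admissible discretisations (`hasSLETrace_three_of_convergesInLawToSLE_zd` with the corrected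
statement supplied by `convergesInLawToSLE_three_isingInterface_zd_of_traversalBound'`).
Rohde–Schramm (2005), Thm. 5.1 at `κ = 3` is the statement witnessed. [folklore] -/
theorem hasSLETrace_three_of_traversalBound_of_isSLELaw
    (h1 : spinInterface_traversalBound) (h2 : isSLELaw_three_of_subseqLimit_spinInterface)
    {D : DobrushinDomain} {E : ℝ → DiscreteDobrushin} (hE : IsDiscretisation D E) :
    HasSLETrace 3 :=
  hasSLETrace_three_of_convergesInLawToSLE_zd
    (convergesInLawToSLE_three_isingInterface_zd_of_traversalBound' h1 h2) hE

/-- **(C1) and F2 entail almost-sure transience of the SLE₃ trace** on every Dobrushin domain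
admitting admissible discretisations (`ae_tendsto_norm_sleTrace_three_of_convergesInLawToSLE_zd`
with `convergesInLawToSLE_three_isingInterface_zd_of_traversalBound'`). Rohde–Schramm (2005),
Thm. 7.1 at `κ = 3` is the statement witnessed. [folklore] -/
theorem ae_tendsto_norm_sleTrace_three_of_traversalBound_of_isSLELaw
    (h1 : spinInterface_traversalBound) (h2 : isSLELaw_three_of_subseqLimit_spinInterface)
    {D : DobrushinDomain} {E : ℝ → DiscreteDobrushin} (hE : IsDiscretisation D E) :
    ∀ᵐ ω ∂Process.preWienerMeasure, Tendsto (fun t => ‖sleTrace 3 ω t‖) atTop atTop :=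
  ae_tendsto_norm_sleTrace_three_of_convergesInLawToSLE_zd
    (convergesInLawToSLE_three_isingInterface_zd_of_traversalBound' h1 h2) hE

end Literature.Probability.LatticeModels
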